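import Summits.BirchSwinnertonDyer.Rank1Residual.X9.MainConjectureInstancesN3
import Summits.BirchSwinnertonDyer.Rank1Residual.X9.ShapiroPairsCertRankZeroB
import Summits.BirchSwinnertonDyer.Rank1Residual.X9.ShapiroPairsCertRankZeroC
import HarnessLib

/-!
# Class X9 (N3), rank `0`: Mazur's cyclotomic main conjecture INTEGRALLY WITH `μ = 0` — Greenberg's Conj. 1.11 — AT THE PAIR, for the
# N3 residue cells that have a kernel `BSDp` theorem (part 2: `207936db1`, `380061c1`, `393129bo1`, `393129bp1`, `484128bw1`)

HONEST FRAMING (cell `b2b-bsdres-*`, verbatim): the cell deletes COMBINATION-SHAPED residual classes of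
the rank-≤1 BSD formula from PUBLISHED theorems only and TYPES the construction-shaped remainder; this
is not "finishing BSD". Class X9 stays TYPED at class level: its typed input `IntegralMainConjectureOnClassX9`
(one integral cyclotomic main conjecture at a good ordinary `p ≥ 5` with `ρ̄_{E,p}` irreducible and NOT surjective
— exactly where Kato's Thm. 17.4 (3) and BCS 2025 Thm. 1.1.2 (b) have no antecedent, `ClassX9.not_bigIm`) stays OPEN
as a ∀-statement. Everything here is PER PAIR; nothing is booked; no named fact. Unit `b2b-bsdres-x9`, gen 15
(class-closure N3 lead: this file is the E1 line 'typed target INHABITED at the pair' of `class-closure/N3/WEEK-2026-08-28.md`).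

WHAT: gen 5's `mazurMainConjecture_with_mu_zero_of_bsdp` (`Rank1Residual/X9MuInvariant.lean`): at a good ordinary
irreducible `p ≥ 5` with `r_an(E) = 0`, BCS 2025 Thm. 1.1.2 (a) gives `char X(E/ℚ_∞) = (g)` with `ι g = p^k·L_p`;
`BSD(E,p)` (through Greenberg Thm. 4.1, the period unit, modularity, GZK) forces `k = 0`, and ONE unit coefficient of
`ϖ·L_p(f_E, α)` (certificate `hcert`) gives `μ(g) = 0`: Mazur's main conjecture for `(E, p)` in `Λ`, with `μ = 0`, at
every cyclotomic datum. HERE it is instantiated at the N3 cells (`class-closure/N3/pairs.tsv`, all `r = 0`) whose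
`BSD(E,p)` is ALREADY a kernel theorem of this lineage with only finite-certificate binders: the `5Ns` cells closed by
an EXACT Shapiro `5`-descent (`X9/ShapiroPairsCert*.lean`, gen 13), the `5S4` cells closed by a Zimmert-certified full
`5`-descent (`X9/S4DescentPairsZimmert*.lean`, `X9/S4DescentChainOnlyPair.lean`, gens 13–14) and the `7Ns` cell
`407277i1` (`X9/ShapiroPairsSevenRankZero.lean`, gen 14). Per record: the pair's `bsdp_s<label>` theorem BY NAME + the
`IntModel` toolkit (good ORDINARY reduction at `p` by the kernel point count `#Ẽ(𝔽_p)`, `E[p]` irreducible by a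
Frobenius witness `ℓ`, Mazur 1978 Prop. 6.3 (1)) + the certificate `hcert` (gen 9 `HOME/b2b-bsdres-x9/g9/mu/MU-ALL.tsv`:
`μ(𝓛_p(E)) = 0` on TWO engines for all 790 X9 pairs). Binders: PUBLISHED `hBCS`, `hGr`, `h5`, `hmodL`, `hGZK`; FINITE
`r_an = 0`, `#Ш_an = q` (`ord_p q = 0`), the descent line `hSel`, `hcert`; instance binders `[IsElliptic]`,
`[IsGloballyMinimal]` dischargeable by Kraus' bounded criterion (as in `X9/TransportPairs*.lean`). So at each of these
pairs Greenberg's Conjecture 1.11 (`μ = 0` for `E[p]` irreducible) HOLDS — for a split-Cartan-normaliser or `𝔖₄`-exceptional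
image — granted published theorems and finite two-engine certificates; the class-level statement is untouched.

References: Greenberg, LNM 1716 (1999) Conj. 1.11, Thm. 4.1; Burungale–Castella–Skinner IMRN 2025 Thm. 1.1.2 (a);
Greenberg–Vatsal 2000 §3 (period unit); Mazur 1978 Prop. 6.3 (1); Cremona's tables.
-/

set_option autoImplicit false

noncomputable section

open scoped Classical MatrixGroups ModularForm

open CongruenceSubgroup WeierstrassCurve Literature.NumberTheory.EllipticCurves
  Literature.NumberTheory.EllipticCurves.ModularForms Literature.NumberTheory.EllipticCurves.Rank1Residual
  Literature.NumberTheory.EllipticCurves.Rank1Residual.Typed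
  Literature.NumberTheory.EllipticCurves.Rank1Residual.X11RankOneCertificates
  Summit.BirchSwinnertonDyer.BirchSwinnertonDyer.Rank1Residual.IntModel
  Summit.BirchSwinnertonDyer.BirchSwinnertonDyer.Rank1Residual.X11RankOne
  Summit.BirchSwinnertonDyer.Rank1Residual.X11b

namespace Summit.BirchSwinnertonDyer.Rank1Residual.X9
/-! ### Kernel data and records -/

/-- `#Ẽ(𝔽₅) = 3` (`a₅ = 3`: good ORDINARY) for Cremona's model `207936db1` (kernel count). [folklore] -/
theorem card_m207936db1_5 :
    Nat.card (((⟨0, 0, 0, -45486, 112226958⟩ : WeierstrassCurve ℤ).map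
      (Int.castRingHom (ZMod 5))).toAffine.Point) = 3 := by
  rw [@WeierstrassCurve.natCard_point_eq_one_add_card (ZMod 5) (@ZMod.instField 5 ⟨by norm_num⟩) _ _ _
    (by decide +kernel), @card_sol_eq_sum_euler (ZMod 5) (@ZMod.instField 5 ⟨by norm_num⟩) _ _
    (by rw [ZMod.ringChar_zmod_n]; decide), ZMod.card]
  decide +kernel

/-- `#Ẽ(𝔽₇) = 3` (`a₇ = 5`; root-free mod `5`) for Cremona's model `207936db1` (kernel count). [folklore] -/
theorem card_m207936db1_7 :
    Nat.card (((⟨0, 0, 0, -45486, 112226958⟩ : WeierstrassCurve ℤ).map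
      (Int.castRingHom (ZMod 7))).toAffine.Point) = 3 := by
  rw [@WeierstrassCurve.natCard_point_eq_one_add_card (ZMod 7) (@ZMod.instField 7 ⟨by norm_num⟩) _ _ _
    (by decide +kernel), @card_sol_eq_sum_euler (ZMod 7) (@ZMod.instField 7 ⟨by norm_num⟩) _ _
    (by rw [ZMod.ringChar_zmod_n]; decide), ZMod.card]
  decide +kernel

/-- **Mazur's main conjecture with `μ = 0` for `(207936db1, 5)`** (Cremona model `[0, 0, 0, -45486, 112226958]`; good ORDINARY at `5`, `a₅ = 3`,
`#Ẽ(𝔽₅) = 3`; `ρ̄_{E,5}` irreducible — Frobenius witness `ℓ = 7`: `#Ẽ(𝔽₇) = 3`, `a₇ = 5`, `X² − a₇X + 7` root-free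
mod `5` — and, census datum, NOT surjective, of split-Cartan-normaliser type `5Ns` (EXACT Shapiro `5`-descent, gen 13); `r_an = 0`, `#Ш_an = 9`): the N3
typed target INHABITED at this pair — from the kernel theorem `bsdp_s207936db1` (`X9/ShapiroPairsCertRankZeroB.lean`, binders `hGZK`, `r_an ≤ 1`,
`#Ш_an` a `5`-adic unit, the descent line `hSel`) and the certificate `hcert` (`μ(𝓛₅(E)) = 0`, gen 9 `MU-ALL.tsv`, two engines).
Per pair; the class-level statement stays OPEN. [cite: GreenbergLNM1716, §1 Conj. 1.11 and Thm. 4.1 (p. 102)]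
[cite: BurungaleCastellaSkinner2025, Thm. 1.1.2 (a) (p. 2 of arXiv:2405.00270v2)] [cite: Cremona2006, Table 1 (Cremona label 207936db1)] -/
theorem mazurMainConjecture_s207936db1
    (hBCS : burungale_castella_skinner_charIdeal_eq_padicLFunction)
    (hGr : greenberg_charValue_rankZero) (h5 : realPeriodRat_eq_unit_mul_plusPeriod)
    (hmodL : hasEntireLFunction_rat) (hGZK : rank_eq_analyticRank_of_analyticRank_le_one)
    (W : WeierstrassCurve ℚ) [W.IsElliptic] [W.IsGloballyMinimal] [Fact (Nat.Prime 5)]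
    (hW : W = ⟨0, 0, 0, -45486, 112226958⟩) (hr : W.analyticRank = 0)
    {q : ℚ} (hq : shaAn W = (q : ℂ)) (hv : padicValRat 5 q = 0)
    (hSel : Nat.card (W.selmerGroup (5 : ℤ)) = 5 ^ W.analyticRank)
    (hcert : ∀ [NeZero (W.conductorNorm ℤ)] (f : CuspForm (Gamma0 (W.conductorNorm ℤ)) 2),
        IsNewformOf W f → ∀ (ϖ : ℚ), (ϖ : ℝ) * W.realPeriodRat = plusPeriod f →
      ∃ m : ℕ, ‖PowerSeries.coeff m
        (PowerSeries.C (ϖ : ℚ_[5]) * padicLFunction f (unitRoot W 5 : ℚ_[5]))‖ = 1) :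
    ∀ (κ : ZpExtension ℚ 5) (γ : Field.absoluteGaloisGroup ℚ),
        κ.IsCyclotomic → κ.IsTopGenerator γ → IsCyclotomicVariable 5 γ →
      ∀ [NeZero (W.conductorNorm ℤ)] (f : CuspForm (Gamma0 (W.conductorNorm ℤ)) 2),
        IsNewformOf W f → ∀ (ϖ : ℚ), (ϖ : ℝ) * W.realPeriodRat = plusPeriod f →
      ∀ (D : W.SelmerDualData κ γ), D.IsTorsion ∧
        ∃ g : IwasawaAlgebra 5, D.charIdeal = Ideal.span {g} ∧
          GreenbergVatsal2000.HasUnitContent g ∧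
          iwasawaToPowerSeries 5 g =
            PowerSeries.C (ϖ : ℚ_[5]) * padicLFunction f (unitRoot W 5 : ℚ_[5]) := by
  have hbsd : BSDp W 5 := bsdp_s207936db1 hGZK W hW (by rw [hr]; norm_num) hq hv hSel
  have hIW : integralModelInt W = ⟨0, 0, 0, -45486, 112226958⟩ :=
    integralModelInt_eq_of_map_eq _ (by rw [hW]; ext <;> simp [WeierstrassCurve.map])
  haveI : Fact (Nat.Prime 7) := ⟨by norm_num⟩
  exact mazurMainConjecture_of_ainvs_of_bsdp hBCS hGr h5 hmodL hGZK 0 0 0 (-45486) 112226958 hIW 5 7 3 3 (by norm_num)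
    (by decide +kernel) card_m207936db1_5 (by decide) (by decide) (by decide +kernel) card_m207936db1_7 (by decide)
    hr hbsd hcert

/-- `#Ẽ(𝔽₅) = 8` (`a₅ = -2`: good ORDINARY) for Cremona's model `380061c1` (kernel count). [folklore] -/
theorem card_m380061c1_5 :
    Nat.card (((⟨0, 0, 1, -1835738256, -30270856666878⟩ : WeierstrassCurve ℤ).map
      (Int.castRingHom (ZMod 5))).toAffine.Point) = 8 := by
  rw [@WeierstrassCurve.natCard_point_eq_one_add_card (ZMod 5) (@ZMod.instField 5 ⟨by norm_num⟩) _ _ _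
    (by decide +kernel), @card_sol_eq_sum_euler (ZMod 5) (@ZMod.instField 5 ⟨by norm_num⟩) _ _
    (by rw [ZMod.ringChar_zmod_n]; decide), ZMod.card]
  decide +kernel

/-- `#Ẽ(𝔽₇) = 8` (`a₇ = 0`; root-free mod `5`) for Cremona's model `380061c1` (kernel count). [folklore] -/
theorem card_m380061c1_7 :
    Nat.card (((⟨0, 0, 1, -1835738256, -30270856666878⟩ : WeierstrassCurve ℤ).map
      (Int.castRingHom (ZMod 7))).toAffine.Point) = 8 := by
  rw [@WeierstrassCurve.natCard_point_eq_one_add_card (ZMod 7) (@ZMod.instField 7 ⟨by norm_num⟩) _ _ _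
    (by decide +kernel), @card_sol_eq_sum_euler (ZMod 7) (@ZMod.instField 7 ⟨by norm_num⟩) _ _
    (by rw [ZMod.ringChar_zmod_n]; decide), ZMod.card]
  decide +kernel

/-- **Mazur's main conjecture with `μ = 0` for `(380061c1, 5)`** (Cremona model `[0, 0, 1, -1835738256, -30270856666878]`; good ORDINARY at `5`, `a₅ = -2`,
`#Ẽ(𝔽₅) = 8`; `ρ̄_{E,5}` irreducible — Frobenius witness `ℓ = 7`: `#Ẽ(𝔽₇) = 8`, `a₇ = 0`, `X² − a₇X + 7` root-free
mod `5` — and, census datum, NOT surjective, of split-Cartan-normaliser type `5Ns` (EXACT Shapiro `5`-descent, gen 13); `r_an = 0`, `#Ш_an = 9`): the N3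
typed target INHABITED at this pair — from the kernel theorem `bsdp_s380061c1` (`X9/ShapiroPairsCertRankZeroC.lean`, binders `hGZK`, `r_an ≤ 1`,
`#Ш_an` a `5`-adic unit, the descent line `hSel`) and the certificate `hcert` (`μ(𝓛₅(E)) = 0`, gen 9 `MU-ALL.tsv`, two engines).
Per pair; the class-level statement stays OPEN. [cite: GreenbergLNM1716, §1 Conj. 1.11 and Thm. 4.1 (p. 102)]
[cite: BurungaleCastellaSkinner2025, Thm. 1.1.2 (a) (p. 2 of arXiv:2405.00270v2)] [cite: Cremona2006, Table 1 (Cremona label 380061c1)] -/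
theorem mazurMainConjecture_s380061c1
    (hBCS : burungale_castella_skinner_charIdeal_eq_padicLFunction)
    (hGr : greenberg_charValue_rankZero) (h5 : realPeriodRat_eq_unit_mul_plusPeriod)
    (hmodL : hasEntireLFunction_rat) (hGZK : rank_eq_analyticRank_of_analyticRank_le_one)
    (W : WeierstrassCurve ℚ) [W.IsElliptic] [W.IsGloballyMinimal] [Fact (Nat.Prime 5)]
    (hW : W = ⟨0, 0, 1, -1835738256, -30270856666878⟩) (hr : W.analyticRank = 0)
    {q : ℚ} (hq : shaAn W = (q : ℂ)) (hv : padicValRat 5 q = 0)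
    (hSel : Nat.card (W.selmerGroup (5 : ℤ)) = 5 ^ W.analyticRank)
    (hcert : ∀ [NeZero (W.conductorNorm ℤ)] (f : CuspForm (Gamma0 (W.conductorNorm ℤ)) 2),
        IsNewformOf W f → ∀ (ϖ : ℚ), (ϖ : ℝ) * W.realPeriodRat = plusPeriod f →
      ∃ m : ℕ, ‖PowerSeries.coeff m
        (PowerSeries.C (ϖ : ℚ_[5]) * padicLFunction f (unitRoot W 5 : ℚ_[5]))‖ = 1) :
    ∀ (κ : ZpExtension ℚ 5) (γ : Field.absoluteGaloisGroup ℚ),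
        κ.IsCyclotomic → κ.IsTopGenerator γ → IsCyclotomicVariable 5 γ →
      ∀ [NeZero (W.conductorNorm ℤ)] (f : CuspForm (Gamma0 (W.conductorNorm ℤ)) 2),
        IsNewformOf W f → ∀ (ϖ : ℚ), (ϖ : ℝ) * W.realPeriodRat = plusPeriod f →
      ∀ (D : W.SelmerDualData κ γ), D.IsTorsion ∧
        ∃ g : IwasawaAlgebra 5, D.charIdeal = Ideal.span {g} ∧
          GreenbergVatsal2000.HasUnitContent g ∧
          iwasawaToPowerSeries 5 g =
            PowerSeries.C (ϖ : ℚ_[5]) * padicLFunction f (unitRoot W 5 : ℚ_[5]) := by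
  have hbsd : BSDp W 5 := bsdp_s380061c1 hGZK W hW (by rw [hr]; norm_num) hq hv hSel
  have hIW : integralModelInt W = ⟨0, 0, 1, -1835738256, -30270856666878⟩ :=
    integralModelInt_eq_of_map_eq _ (by rw [hW]; ext <;> simp [WeierstrassCurve.map])
  haveI : Fact (Nat.Prime 7) := ⟨by norm_num⟩
  exact mazurMainConjecture_of_ainvs_of_bsdp hBCS hGr h5 hmodL hGZK 0 0 1 (-1835738256) (-30270856666878) hIW 5 7 8 8 (by norm_num)
    (by decide +kernel) card_m380061c1_5 (by decide) (by decide) (by decide +kernel) card_m380061c1_7 (by decide)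
    hr hbsd hcert

/-- `#Ẽ(𝔽₅) = 4` (`a₅ = 2`: good ORDINARY) for Cremona's model `393129bo1` (kernel count). [folklore] -/
theorem card_m393129bo1_5 :
    Nat.card (((⟨0, 0, 1, -179266824, -2246835136516⟩ : WeierstrassCurve ℤ).map
      (Int.castRingHom (ZMod 5))).toAffine.Point) = 4 := by
  rw [@WeierstrassCurve.natCard_point_eq_one_add_card (ZMod 5) (@ZMod.instField 5 ⟨by norm_num⟩) _ _ _
    (by decide +kernel), @card_sol_eq_sum_euler (ZMod 5) (@ZMod.instField 5 ⟨by norm_num⟩) _ _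
    (by rw [ZMod.ringChar_zmod_n]; decide), ZMod.card]
  decide +kernel

/-- `#Ẽ(𝔽₁₃) = 19` (`a₁₃ = -5`; root-free mod `5`) for Cremona's model `393129bo1` (kernel count). [folklore] -/
theorem card_m393129bo1_13 :
    Nat.card (((⟨0, 0, 1, -179266824, -2246835136516⟩ : WeierstrassCurve ℤ).map
      (Int.castRingHom (ZMod 13))).toAffine.Point) = 19 := by
  rw [@WeierstrassCurve.natCard_point_eq_one_add_card (ZMod 13) (@ZMod.instField 13 ⟨by norm_num⟩) _ _ _
    (by decide +kernel), @card_sol_eq_sum_euler (ZMod 13) (@ZMod.instField 13 ⟨by norm_num⟩) _ _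
    (by rw [ZMod.ringChar_zmod_n]; decide), ZMod.card]
  decide +kernel

/-- **Mazur's main conjecture with `μ = 0` for `(393129bo1, 5)`** (Cremona model `[0, 0, 1, -179266824, -2246835136516]`; good ORDINARY at `5`, `a₅ = 2`,
`#Ẽ(𝔽₅) = 4`; `ρ̄_{E,5}` irreducible — Frobenius witness `ℓ = 13`: `#Ẽ(𝔽₁₃) = 19`, `a₁₃ = -5`, `X² − a₁₃X + 13` root-free
mod `5` — and, census datum, NOT surjective, of split-Cartan-normaliser type `5Ns` (EXACT Shapiro `5`-descent, gen 13); `r_an = 0`, `#Ш_an = 16`): the N3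
typed target INHABITED at this pair — from the kernel theorem `bsdp_s393129bo1` (`X9/ShapiroPairsCertRankZeroC.lean`, binders `hGZK`, `r_an ≤ 1`,
`#Ш_an` a `5`-adic unit, the descent line `hSel`) and the certificate `hcert` (`μ(𝓛₅(E)) = 0`, gen 9 `MU-ALL.tsv`, two engines).
Per pair; the class-level statement stays OPEN. [cite: GreenbergLNM1716, §1 Conj. 1.11 and Thm. 4.1 (p. 102)]
[cite: BurungaleCastellaSkinner2025, Thm. 1.1.2 (a) (p. 2 of arXiv:2405.00270v2)] [cite: Cremona2006, Table 1 (Cremona label 393129bo1)] -/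
theorem mazurMainConjecture_s393129bo1
    (hBCS : burungale_castella_skinner_charIdeal_eq_padicLFunction)
    (hGr : greenberg_charValue_rankZero) (h5 : realPeriodRat_eq_unit_mul_plusPeriod)
    (hmodL : hasEntireLFunction_rat) (hGZK : rank_eq_analyticRank_of_analyticRank_le_one)
    (W : WeierstrassCurve ℚ) [W.IsElliptic] [W.IsGloballyMinimal] [Fact (Nat.Prime 5)]
    (hW : W = ⟨0, 0, 1, -179266824, -2246835136516⟩) (hr : W.analyticRank = 0)
    {q : ℚ} (hq : shaAn W = (q : ℂ)) (hv : padicValRat 5 q = 0)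
    (hSel : Nat.card (W.selmerGroup (5 : ℤ)) = 5 ^ W.analyticRank)
    (hcert : ∀ [NeZero (W.conductorNorm ℤ)] (f : CuspForm (Gamma0 (W.conductorNorm ℤ)) 2),
        IsNewformOf W f → ∀ (ϖ : ℚ), (ϖ : ℝ) * W.realPeriodRat = plusPeriod f →
      ∃ m : ℕ, ‖PowerSeries.coeff m
        (PowerSeries.C (ϖ : ℚ_[5]) * padicLFunction f (unitRoot W 5 : ℚ_[5]))‖ = 1) :
    ∀ (κ : ZpExtension ℚ 5) (γ : Field.absoluteGaloisGroup ℚ),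
        κ.IsCyclotomic → κ.IsTopGenerator γ → IsCyclotomicVariable 5 γ →
      ∀ [NeZero (W.conductorNorm ℤ)] (f : CuspForm (Gamma0 (W.conductorNorm ℤ)) 2),
        IsNewformOf W f → ∀ (ϖ : ℚ), (ϖ : ℝ) * W.realPeriodRat = plusPeriod f →
      ∀ (D : W.SelmerDualData κ γ), D.IsTorsion ∧
        ∃ g : IwasawaAlgebra 5, D.charIdeal = Ideal.span {g} ∧
          GreenbergVatsal2000.HasUnitContent g ∧
          iwasawaToPowerSeries 5 g =
            PowerSeries.C (ϖ : ℚ_[5]) * padicLFunction f (unitRoot W 5 : ℚ_[5]) := by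
  have hbsd : BSDp W 5 := bsdp_s393129bo1 hGZK W hW (by rw [hr]; norm_num) hq hv hSel
  have hIW : integralModelInt W = ⟨0, 0, 1, -179266824, -2246835136516⟩ :=
    integralModelInt_eq_of_map_eq _ (by rw [hW]; ext <;> simp [WeierstrassCurve.map])
  haveI : Fact (Nat.Prime 13) := ⟨by norm_num⟩
  exact mazurMainConjecture_of_ainvs_of_bsdp hBCS hGr h5 hmodL hGZK 0 0 1 (-179266824) (-2246835136516) hIW 5 13 19 4 (by norm_num)
    (by decide +kernel) card_m393129bo1_5 (by decide) (by decide) (by decide +kernel) card_m393129bo1_13 (by decide)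
    hr hbsd hcert

/-- `#Ẽ(𝔽₅) = 4` (`a₅ = 2`: good ORDINARY) for Cremona's model `393129bp1` (kernel count). [folklore] -/
theorem card_m393129bp1_5 :
    Nat.card (((⟨0, 0, 1, -496584, 327574739⟩ : WeierstrassCurve ℤ).map
      (Int.castRingHom (ZMod 5))).toAffine.Point) = 4 := by
  rw [@WeierstrassCurve.natCard_point_eq_one_add_card (ZMod 5) (@ZMod.instField 5 ⟨by norm_num⟩) _ _ _
    (by decide +kernel), @card_sol_eq_sum_euler (ZMod 5) (@ZMod.instField 5 ⟨by norm_num⟩) _ _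
    (by rw [ZMod.ringChar_zmod_n]; decide), ZMod.card]
  decide +kernel

/-- `#Ẽ(𝔽₁₃) = 9` (`a₁₃ = 5`; root-free mod `5`) for Cremona's model `393129bp1` (kernel count). [folklore] -/
theorem card_m393129bp1_13 :
    Nat.card (((⟨0, 0, 1, -496584, 327574739⟩ : WeierstrassCurve ℤ).map
      (Int.castRingHom (ZMod 13))).toAffine.Point) = 9 := by
  rw [@WeierstrassCurve.natCard_point_eq_one_add_card (ZMod 13) (@ZMod.instField 13 ⟨by norm_num⟩) _ _ _
    (by decide +kernel), @card_sol_eq_sum_euler (ZMod 13) (@ZMod.instField 13 ⟨by norm_num⟩) _ _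
    (by rw [ZMod.ringChar_zmod_n]; decide), ZMod.card]
  decide +kernel

/-- **Mazur's main conjecture with `μ = 0` for `(393129bp1, 5)`** (Cremona model `[0, 0, 1, -496584, 327574739]`; good ORDINARY at `5`, `a₅ = 2`,
`#Ẽ(𝔽₅) = 4`; `ρ̄_{E,5}` irreducible — Frobenius witness `ℓ = 13`: `#Ẽ(𝔽₁₃) = 9`, `a₁₃ = 5`, `X² − a₁₃X + 13` root-free
mod `5` — and, census datum, NOT surjective, of split-Cartan-normaliser type `5Ns` (EXACT Shapiro `5`-descent, gen 13); `r_an = 0`, `#Ш_an = 1`): the N3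
typed target INHABITED at this pair — from the kernel theorem `bsdp_s393129bp1` (`X9/ShapiroPairsCertRankZeroC.lean`, binders `hGZK`, `r_an ≤ 1`,
`#Ш_an` a `5`-adic unit, the descent line `hSel`) and the certificate `hcert` (`μ(𝓛₅(E)) = 0`, gen 9 `MU-ALL.tsv`, two engines).
Per pair; the class-level statement stays OPEN. [cite: GreenbergLNM1716, §1 Conj. 1.11 and Thm. 4.1 (p. 102)]
[cite: BurungaleCastellaSkinner2025, Thm. 1.1.2 (a) (p. 2 of arXiv:2405.00270v2)] [cite: Cremona2006, Table 1 (Cremona label 393129bp1)] -/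
theorem mazurMainConjecture_s393129bp1
    (hBCS : burungale_castella_skinner_charIdeal_eq_padicLFunction)
    (hGr : greenberg_charValue_rankZero) (h5 : realPeriodRat_eq_unit_mul_plusPeriod)
    (hmodL : hasEntireLFunction_rat) (hGZK : rank_eq_analyticRank_of_analyticRank_le_one)
    (W : WeierstrassCurve ℚ) [W.IsElliptic] [W.IsGloballyMinimal] [Fact (Nat.Prime 5)]
    (hW : W = ⟨0, 0, 1, -496584, 327574739⟩) (hr : W.analyticRank = 0)
    {q : ℚ} (hq : shaAn W = (q : ℂ)) (hv : padicValRat 5 q = 0)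
    (hSel : Nat.card (W.selmerGroup (5 : ℤ)) = 5 ^ W.analyticRank)
    (hcert : ∀ [NeZero (W.conductorNorm ℤ)] (f : CuspForm (Gamma0 (W.conductorNorm ℤ)) 2),
        IsNewformOf W f → ∀ (ϖ : ℚ), (ϖ : ℝ) * W.realPeriodRat = plusPeriod f →
      ∃ m : ℕ, ‖PowerSeries.coeff m
        (PowerSeries.C (ϖ : ℚ_[5]) * padicLFunction f (unitRoot W 5 : ℚ_[5]))‖ = 1) :
    ∀ (κ : ZpExtension ℚ 5) (γ : Field.absoluteGaloisGroup ℚ),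
        κ.IsCyclotomic → κ.IsTopGenerator γ → IsCyclotomicVariable 5 γ →
      ∀ [NeZero (W.conductorNorm ℤ)] (f : CuspForm (Gamma0 (W.conductorNorm ℤ)) 2),
        IsNewformOf W f → ∀ (ϖ : ℚ), (ϖ : ℝ) * W.realPeriodRat = plusPeriod f →
      ∀ (D : W.SelmerDualData κ γ), D.IsTorsion ∧
        ∃ g : IwasawaAlgebra 5, D.charIdeal = Ideal.span {g} ∧
          GreenbergVatsal2000.HasUnitContent g ∧
          iwasawaToPowerSeries 5 g =
            PowerSeries.C (ϖ : ℚ_[5]) * padicLFunction f (unitRoot W 5 : ℚ_[5]) := by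
  have hbsd : BSDp W 5 := bsdp_s393129bp1 hGZK W hW (by rw [hr]; norm_num) hq hv hSel
  have hIW : integralModelInt W = ⟨0, 0, 1, -496584, 327574739⟩ :=
    integralModelInt_eq_of_map_eq _ (by rw [hW]; ext <;> simp [WeierstrassCurve.map])
  haveI : Fact (Nat.Prime 13) := ⟨by norm_num⟩
  exact mazurMainConjecture_of_ainvs_of_bsdp hBCS hGr h5 hmodL hGZK 0 0 1 (-496584) 327574739 hIW 5 13 9 4 (by norm_num)
    (by decide +kernel) card_m393129bp1_5 (by decide) (by decide) (by decide +kernel) card_m393129bp1_13 (by decide)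
    hr hbsd hcert

/-- `#Ẽ(𝔽₅) = 3` (`a₅ = 3`: good ORDINARY) for Cremona's model `484128bw1` (kernel count). [folklore] -/
theorem card_m484128bw1_5 :
    Nat.card (((⟨0, 0, 0, -1517020131, -22742340543898⟩ : WeierstrassCurve ℤ).map
      (Int.castRingHom (ZMod 5))).toAffine.Point) = 3 := by
  rw [@WeierstrassCurve.natCard_point_eq_one_add_card (ZMod 5) (@ZMod.instField 5 ⟨by norm_num⟩) _ _ _
    (by decide +kernel), @card_sol_eq_sum_euler (ZMod 5) (@ZMod.instField 5 ⟨by norm_num⟩) _ _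
    (by rw [ZMod.ringChar_zmod_n]; decide), ZMod.card]
  decide +kernel

/-- `#Ẽ(𝔽₁₃) = 19` (`a₁₃ = -5`; root-free mod `5`) for Cremona's model `484128bw1` (kernel count). [folklore] -/
theorem card_m484128bw1_13 :
    Nat.card (((⟨0, 0, 0, -1517020131, -22742340543898⟩ : WeierstrassCurve ℤ).map
      (Int.castRingHom (ZMod 13))).toAffine.Point) = 19 := by
  rw [@WeierstrassCurve.natCard_point_eq_one_add_card (ZMod 13) (@ZMod.instField 13 ⟨by norm_num⟩) _ _ _
    (by decide +kernel), @card_sol_eq_sum_euler (ZMod 13) (@ZMod.instField 13 ⟨by norm_num⟩) _ _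
    (by rw [ZMod.ringChar_zmod_n]; decide), ZMod.card]
  decide +kernel

/-- **Mazur's main conjecture with `μ = 0` for `(484128bw1, 5)`** (Cremona model `[0, 0, 0, -1517020131, -22742340543898]`; good ORDINARY at `5`, `a₅ = 3`,
`#Ẽ(𝔽₅) = 3`; `ρ̄_{E,5}` irreducible — Frobenius witness `ℓ = 13`: `#Ẽ(𝔽₁₃) = 19`, `a₁₃ = -5`, `X² − a₁₃X + 13` root-free
mod `5` — and, census datum, NOT surjective, of split-Cartan-normaliser type `5Ns` (EXACT Shapiro `5`-descent, gen 13); `r_an = 0`, `#Ш_an = 9`): the N3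
typed target INHABITED at this pair — from the kernel theorem `bsdp_s484128bw1` (`X9/ShapiroPairsCertRankZeroC.lean`, binders `hGZK`, `r_an ≤ 1`,
`#Ш_an` a `5`-adic unit, the descent line `hSel`) and the certificate `hcert` (`μ(𝓛₅(E)) = 0`, gen 9 `MU-ALL.tsv`, two engines).
Per pair; the class-level statement stays OPEN. [cite: GreenbergLNM1716, §1 Conj. 1.11 and Thm. 4.1 (p. 102)]
[cite: BurungaleCastellaSkinner2025, Thm. 1.1.2 (a) (p. 2 of arXiv:2405.00270v2)] [cite: Cremona2006, Table 1 (Cremona label 484128bw1)] -/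
theorem mazurMainConjecture_s484128bw1
    (hBCS : burungale_castella_skinner_charIdeal_eq_padicLFunction)
    (hGr : greenberg_charValue_rankZero) (h5 : realPeriodRat_eq_unit_mul_plusPeriod)
    (hmodL : hasEntireLFunction_rat) (hGZK : rank_eq_analyticRank_of_analyticRank_le_one)
    (W : WeierstrassCurve ℚ) [W.IsElliptic] [W.IsGloballyMinimal] [Fact (Nat.Prime 5)]
    (hW : W = ⟨0, 0, 0, -1517020131, -22742340543898⟩) (hr : W.analyticRank = 0)
    {q : ℚ} (hq : shaAn W = (q : ℂ)) (hv : padicValRat 5 q = 0)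
    (hSel : Nat.card (W.selmerGroup (5 : ℤ)) = 5 ^ W.analyticRank)
    (hcert : ∀ [NeZero (W.conductorNorm ℤ)] (f : CuspForm (Gamma0 (W.conductorNorm ℤ)) 2),
        IsNewformOf W f → ∀ (ϖ : ℚ), (ϖ : ℝ) * W.realPeriodRat = plusPeriod f →
      ∃ m : ℕ, ‖PowerSeries.coeff m
        (PowerSeries.C (ϖ : ℚ_[5]) * padicLFunction f (unitRoot W 5 : ℚ_[5]))‖ = 1) :
    ∀ (κ : ZpExtension ℚ 5) (γ : Field.absoluteGaloisGroup ℚ),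
        κ.IsCyclotomic → κ.IsTopGenerator γ → IsCyclotomicVariable 5 γ →
      ∀ [NeZero (W.conductorNorm ℤ)] (f : CuspForm (Gamma0 (W.conductorNorm ℤ)) 2),
        IsNewformOf W f → ∀ (ϖ : ℚ), (ϖ : ℝ) * W.realPeriodRat = plusPeriod f →
      ∀ (D : W.SelmerDualData κ γ), D.IsTorsion ∧
        ∃ g : IwasawaAlgebra 5, D.charIdeal = Ideal.span {g} ∧
          GreenbergVatsal2000.HasUnitContent g ∧
          iwasawaToPowerSeries 5 g =
            PowerSeries.C (ϖ : ℚ_[5]) * padicLFunction f (unitRoot W 5 : ℚ_[5]) := by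
  have hbsd : BSDp W 5 := bsdp_s484128bw1 hGZK W hW (by rw [hr]; norm_num) hq hv hSel
  have hIW : integralModelInt W = ⟨0, 0, 0, -1517020131, -22742340543898⟩ :=
    integralModelInt_eq_of_map_eq _ (by rw [hW]; ext <;> simp [WeierstrassCurve.map])
  haveI : Fact (Nat.Prime 13) := ⟨by norm_num⟩
  exact mazurMainConjecture_of_ainvs_of_bsdp hBCS hGr h5 hmodL hGZK 0 0 0 (-1517020131) (-22742340543898) hIW 5 13 19 3 (by norm_num)
    (by decide +kernel) card_m484128bw1_5 (by decide) (by decide) (by decide +kernel) card_m484128bw1_13 (by decide)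
    hr hbsd hcert

end Summit.BirchSwinnertonDyer.Rank1Residual.X9

end
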